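/-
Copyright: lit-balaban Phase-2 proof seat p09 (gen 8).  Statement-level skeleton of a published paper; no proof claims beyond what the
kernel checks below.
-/
import Literature.MathematicalPhysics.QuantumFieldTheory.BalabanImbrieJaffe1984to88.BIJ88ClocEstimatesTorus
import Literature.MathematicalPhysics.QuantumFieldTheory.Balaban1983to89.B5Eq112RenormTransf

/-!
# `BalabanImbrieJaffe1984to88.BIJ88Eq211ClocTorus` — T. Bałaban, J. Imbrie, A. Jaffe, *Effective action and cluster properties of the
abelian Higgs model*, Commun. Math. Phys. **114** (1988) 257–315 [BalabanImbrieJaffe1988], p. 261 [PDF 5]: **(2.11)** — the AXIAL-GAUGE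
CONSTRAINTS OF THE LOCALIZED COVARIANCE — FOR THE `C^{(k)}_{loc}` OF RECORD ON THE TORI, WITH NO HYPOTHESIS, through the pointwise form of the
centred axial gauge of the V1 torus calculus ([BalabanImbrieJaffe1985] (3.4): *"u_b = 1 on every bond of the maximal block trees"*) (file 3
of the p09 gen-8 programme; files 1–2 = `BIJ88ClocFactorsTorus`, `BIJ88ClocEstimatesTorus`)

statement-level skeleton of published theorems with citation tags; proofs where landed; nothing here is a claim about the Yang–Mills mass gap

PDF held: `paper:balaban1988-cmp114-bij-abelian-higgs-effective-action` (journal page = PDF page + 256), p. 261 [PDF 5] re-read this session from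
the text layer; [2] = [BalabanImbrieJaffe1985] (`paper:balaban1985-cmp97-bij-higgs-minimizers`) p. 303 / (3.4) p. 306.

CITATION HEADER (lean-in-tree rule).  Part of the lit-balaban TYPED SKELETON (HOME `run/shared/lean/pub/lit-balaban/`), Phase 2, seat p09 GEN 8
(unit `lit-balaban-p09`; TAKING line HOME/STATUS.md 2026-08-21T20:44:46Z); row **C2.Eq2.11** of `HOME/SKELETON.md` (C2 §§1–4 fold owner r18,
referee ref-5), which before this file read *"proved p247020 (model instance on the C1 surface-bond carriers; the axial-gauge content «C^{(k)}
vanishes on tree rows/columns» is the hypothesis)"* — here that hypothesis is DISCHARGED for the `C^{(k)}` of record; and rows **C1.Eq3.4-3.6 /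
C1.Txt@303** (owner r15) for the centred-tree form of the axial gauge.  Decls used BY NAME: p02's `BIJ88Eq211Proof.clocKer_row_zero`/
`clocKer_col_zero`/`qsKer_interior`/`qsstKer_interior`, r18's `BIJ88Sect2Statements.Eq211`, p16's `B5Eq112RenormTransf.isAxial_iff_forall`,
files 1–2 (`Cmat`, `Cmat_apply`, `Cmat_symm`, `CE_mem_Wstep`, `Ctil`, `Ctil_apply`, `Cloc`), p30's `BIJ85Prop521Torus.mem_Wstep`.

THE PRINTED TEXT (verbatim, p. 261 [PDF 5]).  *"this insures that C^{(k)}_{loc}, like C^{(k)}, satisfies the constraints from the renormalization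
transformation and from the axial gauge conditions: QC^{(k)}_{loc} = C^{(k)}_{loc}Q* = 0, (2.10)  Σ_{b∈Γ_{y,x}} C^{(k)}_{loc}(b,b₀) =
Σ_{b∈Γ_{y,x}} C^{(k)}_{loc}(b₀,b) = 0. (2.11)"*; [2] p. 303: *"We fix the axial gauge by setting u_b = 1 for every bond b of the trees T(y)
= ⋃_{x∈B(y)} Γ_{yx}"*, (3.4).

THE OBJECTS.  The tori of `Balaban1983to89.Setup` with the CENTRED blocks and the staircase contours `Γ_{y,x}` of `LatticeFieldCalculus` (from
the block centre `emb y` to `x ∈ B(y)`, coordinates changed in the order `d, …, 1`, signed runs — the convention of the `Wstep` on which the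
`C^{(k)}` of record lives; DIVERGENCE F3 of the cell: [2] anchors blocks and trees at the corner); `IsStairTreeBond b` — `b` is a bond of one of
these trees: `b = ⟨(y, s), μ⟩` with the offsets `s_κ = (L−1)/2` (centre) for `κ < μ` and `s_μ + 1 < L`; `Cmat`/`Ctil`/`Cloc` of files 1–2.

WHAT IS PROVED (0 `sorry`, standard axioms, no named facts).
* §1 THE CENTRED AXIAL GAUGE IS POINTWISE: `runSum_add_one_sub` (one more step of a signed run), `stairSum_update_succ_sub` (moving the tip of a
  staircase by `e_μ`, the lower coordinates at the centre, adds exactly `A_{⟨x,μ⟩}` — prefixes of staircases are staircases), `valMinAbs_blockSite_sub_emb`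
  (the signed run lengths `s_μ − (L−1)/2`), **`apply_eq_zero_of_isAxial`** (`A(Γ_{y,x}) = 0 ∀x ⇒ A_b = 0` on every stair-tree bond),
  **`isAxial_of_forall_tree`** (conversely, every staircase bond is a stair-tree bond), **`isAxial_iff_forall_tree`**; `blockOf_tgt_eq_of_tree`
  (tree bonds are interior).
* §2 **(2.11) FOR THE `C^{(k)}_{loc}` OF RECORD, NO HYPOTHESIS** (`j + 1 ≤ m + K`; the row statements also `d ≥ 2`): `isAxial_Cmat_col` (every column
  of `C^{(k)}` is axial — range `⊆ Wstep`), `Cmat_eq_zero_of_tree_left/right` (`C^{(k)}(b,b′) = 0` if `b` or `b′` is a tree bond),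
  `Ctil_eq_zero_of_tree_left/right` ((2.8) keeps it), **`Cloc_eq_zero_of_tree_left/right`** (p02's mechanism `clocKer_row_zero`/`_col_zero` with
  ALL FOUR hypotheses discharged: tree rows/columns of `C̃` vanish, `Q^{s*}`/`Q^s` vanish at the interior tree bonds), hence the printed display in
  both of its readings: **`isAxial_Cloc_col`**, **`isAxial_Cloc_row`** (the signed staircase sums `C_loc(Γ_{y,x}, b₀) = C_loc(b₀, Γ_{y,x}) = 0` of the
  torus calculus) and r18's typed **`eq211_Cloc : Eq211 Γ (Cloc P j R)`** for EVERY family `Γ` of bond sets drawn from the trees.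
HONEST SCOPE.  Torus, U(1), real fields; centred blocks/trees (the cell's V1 convention, not [2]'s corner anchoring — the two gauges are related
by gen 6's block-local regauging `BIJ85Ineq723Torus.regauge`, not restated); `j + 1 ≤ m + K`.  One `def` (`IsStairTreeBond`, a `Prop`-valued
predicate on bonds with a body — a definition, not a named fact), no `def … : Prop` statement, no new named fact (D-0026).  NOTHING beyond the
kernel-checked statements is asserted; NOT summit progress.  Unit `lit-balaban-p09` (literature-prover-lit-balaban-p09-g8-0), 2026-08-21.
-/

namespace Literature.MathematicalPhysics.QuantumFieldTheory.BalabanImbrieJaffe1984to88.BIJ88Eq211ClocTorus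

open Literature.MathematicalPhysics.QuantumFieldTheory.Balaban1983to89
open scoped BigOperators Matrix RealInnerProductSpace
open LatticeFieldCalculus BIJ85Sect2SurfaceAverages BIJ85Eq219Proof BIJ85Eq213Adjoint BIJ88Eq211Proof
open BIJ88Sect2Statements (trunc Eq211)
open BIJ85Prop521Torus (CoarseSpace toEj Wstep mem_Wstep)
open BIJ85Prop522Torus (CE)
open B5Eq112RenormTransf (isAxial_iff_forall)
open BIJ88ClocFactorsTorus BIJ88ClocEstimatesTorus

noncomputable section

/-! ## §1  The centred axial gauge is pointwise: `A(Γ_{y,x}) = 0 ∀ x ⇔ A_b = 0` on the staircase trees -/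

section Stair

variable {P : Params} {j : ℕ} {V : Type*} [AddCommGroup V]

/-- a signed run of negative length, unfolded: `A([z − (m+1)e_μ, z])` traversed backwards with minus signs. [cite: Balaban1984PropagatorsI, (1.7) p.18] -/
theorem runSum_negSucc (A : VecField P j V) (z : Balaban1983to89.Site P j) (μ : Fin P.d) (m : ℕ) :
    runSum A z μ (Int.negSucc m) =
      -∑ t ∈ Finset.range (m + 1), A ⟨Function.update z μ (z μ - ((t + 1 : ℕ) : ZMod (P.sitesPerDir j))), μ⟩ := rfl

/-- **one more step of a signed straight run**: `A(run of n+1 steps from z) − A(run of n steps from z) = A_{⟨z + ne_μ, μ⟩}` for every `n ∈ ℤ`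
(forward bond added for `n ≥ 0`, backward bond removed for `n < 0`). [cite: Balaban1984PropagatorsI, (1.7) p.18] -/
theorem runSum_add_one_sub (A : VecField P j V) (z : Balaban1983to89.Site P j) (μ : Fin P.d) (n : ℤ) :
    runSum A z μ (n + 1) - runSum A z μ n = A ⟨Function.update z μ (z μ + (n : ZMod (P.sitesPerDir j))), μ⟩ := by
  rcases n with k | m
  · have h1 : (Int.ofNat k : ℤ) + 1 = ((k + 1 : ℕ) : ℤ) := by push_cast; rfl
    rw [h1, show (Int.ofNat k : ℤ) = (k : ℤ) from rfl, runSum_ofNat, runSum_ofNat, segSum, segSum, Finset.sum_range_succ,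
      add_sub_cancel_left]
    simp only [runBond, runSite, Int.cast_natCast]
  · rcases m with _ | m
    · have h1 : Int.negSucc 0 + 1 = 0 := rfl
      rw [h1, runSum_zero, runSum_negSucc, zero_sub, neg_neg, Finset.sum_range_one]
      congr 3
      simp only [Int.cast_negSucc, zero_add, Nat.cast_one, sub_eq_add_neg]
    · have h1 : Int.negSucc (m + 1) + 1 = Int.negSucc m := rfl
      rw [h1, runSum_negSucc, runSum_negSucc, Finset.sum_range_succ _ (m + 1), sub_neg_eq_add, neg_add_eq_sub, add_sub_cancel_left]
      congr 3
      simp only [Int.cast_negSucc, sub_eq_add_neg]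

/-- **moving the tip of a staircase by one step**: if the coordinates of `x` below `μ` are those of the base point `y₀` (no runs below `μ`) and the
signed `μ`-displacement grows by one (`valMinAbs(x_μ + 1 − y₀,μ) = valMinAbs(x_μ − y₀,μ) + 1`, no wrap-around), then
`A(Γ_{y₀, x + e_μ}) − A(Γ_{y₀, x}) = A_{⟨x, μ⟩}` — the staircase to `x` is a prefix of the staircase to `x + e_μ`.
[cite: BalabanImbrieJaffe1985, (3.4) p.306] -/
theorem stairSum_update_succ_sub (A : VecField P j V) {y₀ x : Balaban1983to89.Site P j} {μ : Fin P.d}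
    (h1 : ∀ κ, κ < μ → x κ = y₀ κ)
    (h2 : ((x μ + 1) - y₀ μ).valMinAbs = (x μ - y₀ μ).valMinAbs + 1) :
    stairSum A y₀ (Function.update x μ (x μ + 1)) - stairSum A y₀ x = A ⟨x, μ⟩ := by
  set x₂ := Function.update x μ (x μ + 1) with hx₂
  have hmix : ∀ ν, μ ≤ ν → mixSite ν y₀ x₂ = mixSite ν y₀ x := by
    intro ν hν
    funext κ
    simp only [mixSite]
    split_ifs with hκ
    · have hne : κ ≠ μ := fun h => by subst h; exact absurd hκ (not_lt.mpr hν)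
      rw [hx₂, Function.update_of_ne hne]
    · rfl
  unfold stairSum
  rw [← Finset.sum_sub_distrib, Finset.sum_eq_single μ]
  · rw [hmix μ le_rfl]
    have hx₂μ : x₂ μ = x μ + 1 := by rw [hx₂, Function.update_self]
    rw [hx₂μ, h2, runSum_add_one_sub]
    congr 2
    funext κ
    by_cases hκ : κ = μ
    · subst hκ
      rw [Function.update_self]
      simp only [mixSite, lt_irrefl, if_false]
      rw [ZMod.coe_valMinAbs]
      abel
    · rw [Function.update_of_ne hκ]
      simp only [mixSite]
      split_ifs with hlt
      · rfl
      · exact (h1 κ (lt_of_le_of_ne (not_lt.mp hlt) hκ)).symm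
  · intro ν _ hν
    rcases lt_or_gt_of_ne hν with hlt | hgt
    · have e2 : x₂ ν = y₀ ν := by rw [hx₂, Function.update_of_ne (ne_of_lt hlt)]; exact h1 ν hlt
      have e1 : x ν = y₀ ν := h1 ν hlt
      rw [e1, e2, sub_self, ZMod.valMinAbs_zero, runSum_zero, runSum_zero, sub_self]
    · have e2 : x₂ ν = x ν := by rw [hx₂, Function.update_of_ne (ne_of_gt hgt)]
      rw [hmix ν hgt.le, e2, sub_self]
  · intro h
    exact absurd (Finset.mem_univ μ) h

/-- `2L ≤` the site count per direction (standing range). [folklore] -/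
private theorem two_mul_L_le_sitesPerDir (hj : j + 1 ≤ P.m + P.K) : 2 * P.L ≤ P.sitesPerDir j := by
  rw [P.sitesPerDir_eq_mul_succ hj]
  exact Nat.mul_le_mul_right _ (P.one_lt_sitesPerDir (j + 1))

/-- the signed length of the `μ`-run of `Γ_{emb y, x}`, `x = (y, s)`: `s_μ − (L−1)/2` (least-absolute-value representative; no wrap-around in the
standing range; p16's private lemma of `B5Eq112RenormTransf` re-derived). [cite: Balaban1984PropagatorsI, (1.7) p.18] -/
theorem valMinAbs_blockSite_sub_emb (hj : j + 1 ≤ P.m + P.K) (y : Balaban1983to89.Site P (j + 1)) (s : Fin P.d → Fin P.L) (μ : Fin P.d) :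
    ((Balaban1983to89.Site.blockSite y s) μ - (emb y) μ).valMinAbs = ((s μ : ℕ) : ℤ) - (((P.L - 1) / 2 : ℕ) : ℤ) := by
  rw [ZMod.valMinAbs_spec]
  have hr := (s μ).isLt
  have hL : 1 < P.L := P.hL.2
  have h2L := two_mul_L_le_sitesPerDir (P := P) hj
  have hh : (P.L - 1) / 2 < P.L := by omega
  have h2 : 2 * (P.L : ℤ) ≤ (P.sitesPerDir j : ℤ) := by exact_mod_cast h2L
  refine ⟨?_, ?_, ?_⟩
  · have e1 : (Balaban1983to89.Site.blockSite y s) μ = (((y μ).val * P.L + s μ : ℕ) : ZMod (P.sitesPerDir j)) := rfl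
    have e2 : (emb y) μ = (((y μ).val * P.L + (P.L - 1) / 2 : ℕ) : ZMod (P.sitesPerDir j)) := rfl
    rw [e1, e2, Int.cast_sub, Int.cast_natCast, Int.cast_natCast, Nat.cast_add, Nat.cast_add, add_sub_add_left_eq_sub]
  · have h1 : (((P.L - 1) / 2 : ℕ) : ℤ) < (P.L : ℤ) := by exact_mod_cast hh
    have h3 : (0 : ℤ) ≤ ((s μ : ℕ) : ℤ) := Int.natCast_nonneg _
    linarith
  · have h1 : ((s μ : ℕ) : ℤ) < (P.L : ℤ) := by exact_mod_cast hr
    have h3 : (0 : ℤ) ≤ (((P.L - 1) / 2 : ℕ) : ℤ) := Int.natCast_nonneg _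
    linarith

/-- **the bonds of the centred staircase trees** `T(y) = ⋃_{x∈B(y)} Γ_{y,x}` of the torus calculus: the bond `⟨(y, s), μ⟩` of `B(y)` with offsets
`s_κ = (L−1)/2` for `κ < μ` (the coordinates not yet changed are at the centre) and `s_μ + 1 < L` (the bond stays in the block) — the `μ`-runs of
the staircases `Γ_{emb y, x}`, `x ∈ B(y)`, with the coordinates changed in the order `d, …, 1`. [cite: BalabanImbrieJaffe1985, (3.4) p.306] -/
def IsStairTreeBond {P : Params} {j : ℕ} (b : PBond P j) : Prop :=
  ∃ (y : Balaban1983to89.Site P (j + 1)) (s : Fin P.d → Fin P.L), b.src = Balaban1983to89.Site.blockSite y s ∧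
    (∀ κ, κ < b.dir → (s κ : ℕ) = (P.L - 1) / 2) ∧ (s b.dir : ℕ) + 1 < P.L

/-- lower coordinates at the centre: `(y, s)_κ = (emb y)_κ` when `s_κ = (L−1)/2`. [cite: Balaban1987RG1, (0.1) p.252] -/
theorem blockSite_apply_eq_emb {y : Balaban1983to89.Site P (j + 1)} {s : Fin P.d → Fin P.L} {κ : Fin P.d}
    (h : (s κ : ℕ) = (P.L - 1) / 2) : Balaban1983to89.Site.blockSite y s κ = emb y κ := by
  simp only [Balaban1983to89.Site.blockSite, emb, h]

/-- **THE CENTRED AXIAL GAUGE IS POINTWISE, first half**: if `A(Γ_{y,x}) = 0` for all block points `x` ([2] (3.4) / [6I] (1.10), `IsAxial`), then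
`A_b = 0` on every bond of the staircase trees (difference of the staircase sums to the two endpoints of `b`, which are prefixes of one another).
[cite: BalabanImbrieJaffe1985, (3.4) p.306] -/
theorem apply_eq_zero_of_isAxial (hj : j + 1 ≤ P.m + P.K) {A : VecField P j V} (hA : IsAxial A) {b : PBond P j}
    (hb : IsStairTreeBond b) : A b = 0 := by
  obtain ⟨y, s, hsrc, hlow, hlt⟩ := hb
  obtain ⟨x, μ⟩ := b
  simp only at hsrc hlow hlt
  subst hsrc
  set s' : Fin P.d → Fin P.L := Function.update s μ ⟨(s μ : ℕ) + 1, hlt⟩ with hs'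
  have hx' : Function.update (Balaban1983to89.Site.blockSite y s) μ (Balaban1983to89.Site.blockSite y s μ + 1) =
      Balaban1983to89.Site.blockSite y s' := by
    funext κ
    by_cases hκ : κ = μ
    · subst hκ
      rw [Function.update_self]
      simp only [Balaban1983to89.Site.blockSite, hs', Function.update_self]
      push_cast
      ring
    · rw [Function.update_of_ne hκ]
      simp only [Balaban1983to89.Site.blockSite, hs', Function.update_of_ne hκ]
  have h1 : ∀ κ, κ < μ → Balaban1983to89.Site.blockSite y s κ = emb y κ := fun κ hκ => blockSite_apply_eq_emb (hlow κ hκ)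
  have h2 : ((Balaban1983to89.Site.blockSite y s μ + 1) - emb y μ).valMinAbs =
      (Balaban1983to89.Site.blockSite y s μ - emb y μ).valMinAbs + 1 := by
    have e := congrFun hx' μ
    rw [Function.update_self] at e
    rw [e, valMinAbs_blockSite_sub_emb hj, valMinAbs_blockSite_sub_emb hj]
    simp only [hs', Function.update_self]
    push_cast
    ring
  have hdiff := stairSum_update_succ_sub A h1 h2
  rw [hx', (isAxial_iff_forall A).1 hA y s', (isAxial_iff_forall A).1 hA y s, sub_self] at hdiff
  exact hdiff.symm

/-- the site `t` steps along the `μ`-run of `Γ_{emb y, (y,r)}` (forward case), as a block point: offsets `(L−1)/2` below `μ`, `(L−1)/2 + t` at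
`μ`, `r_κ` above `μ`. [cite: Balaban1984PropagatorsI, (1.7) p.18] -/
private theorem runSite_mixSite_eq (y : Balaban1983to89.Site P (j + 1)) (r : Fin P.d → Fin P.L) (μ : Fin P.d) {t : ℕ}
    (ht : (P.L - 1) / 2 + t < P.L) :
    runSite (mixSite μ (emb y) (Balaban1983to89.Site.blockSite y r)) μ t =
      Balaban1983to89.Site.blockSite y (fun κ => if κ < μ then ⟨(P.L - 1) / 2, by omega⟩
        else if κ = μ then ⟨(P.L - 1) / 2 + t, ht⟩ else r κ) := by
  funext κ
  by_cases hκ : κ = μ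
  · subst hκ
    simp only [runSite, Function.update_self, mixSite, lt_irrefl, if_false, if_true, emb, Balaban1983to89.Site.blockSite]
    push_cast
    ring
  · simp only [runSite, Function.update_of_ne hκ, mixSite, Balaban1983to89.Site.blockSite, emb]
    by_cases hlt : μ < κ
    · have : ¬ κ < μ := not_lt.mpr hlt.le
      simp only [hlt, if_true, this, if_false, hκ]
    · have hlt' : κ < μ := lt_of_le_of_ne (not_lt.mp hlt) hκ
      simp only [hlt, if_false, hlt', if_true]

/-- the site `t + 1` steps backwards along the `μ`-run of `Γ_{emb y, (y,r)}` (backward case), as a block point: offsets `(L−1)/2` below `μ`,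
`(L−1)/2 − (t+1)` at `μ`, `r_κ` above `μ`. [cite: Balaban1984PropagatorsI, (1.7) p.18] -/
private theorem update_mixSite_sub_eq (y : Balaban1983to89.Site P (j + 1)) (r : Fin P.d → Fin P.L) (μ : Fin P.d) {t : ℕ}
    (ht : t + 1 ≤ (P.L - 1) / 2) (hL : (P.L - 1) / 2 < P.L) :
    Function.update (mixSite μ (emb y) (Balaban1983to89.Site.blockSite y r)) μ
        (mixSite μ (emb y) (Balaban1983to89.Site.blockSite y r) μ - ((t + 1 : ℕ) : ZMod (P.sitesPerDir j))) =
      Balaban1983to89.Site.blockSite y (fun κ => if κ < μ then ⟨(P.L - 1) / 2, hL⟩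
        else if κ = μ then ⟨(P.L - 1) / 2 - (t + 1), by omega⟩ else r κ) := by
  funext κ
  by_cases hκ : κ = μ
  · subst hκ
    simp only [Function.update_self, mixSite, lt_irrefl, if_false, if_true, emb, Balaban1983to89.Site.blockSite]
    have e : (y κ).val * P.L + (P.L - 1) / 2 = ((y κ).val * P.L + ((P.L - 1) / 2 - (t + 1))) + (t + 1) := by omega
    rw [e, Nat.cast_add, add_sub_cancel_right]
  · simp only [Function.update_of_ne hκ, mixSite, Balaban1983to89.Site.blockSite, emb]
    by_cases hlt : μ < κ
    · have : ¬ κ < μ := not_lt.mpr hlt.le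
      simp only [hlt, if_true, this, if_false, hκ]
    · have hlt' : κ < μ := lt_of_le_of_ne (not_lt.mp hlt) hκ
      simp only [hlt, if_false, hlt', if_true]

/-- **THE CENTRED AXIAL GAUGE IS POINTWISE, second half**: a bond field vanishing on every stair-tree bond is axial — every bond of every
staircase `Γ_{emb y, x}`, `x ∈ B(y)`, is a stair-tree bond. [cite: BalabanImbrieJaffe1985, (3.4) p.306] -/
theorem isAxial_of_forall_tree (hj : j + 1 ≤ P.m + P.K) {A : VecField P j V} (hA : ∀ b : PBond P j, IsStairTreeBond b → A b = 0) :
    IsAxial A := by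
  rw [isAxial_iff_forall]
  intro y r
  unfold stairSum
  refine Finset.sum_eq_zero fun μ _ => ?_
  have hL : 1 < P.L := P.hL.2
  have hr := (r μ).isLt
  rw [valMinAbs_blockSite_sub_emb hj]
  rcases le_or_gt ((P.L - 1) / 2) (r μ : ℕ) with hle | hgt
  · -- forward run of `r_μ − (L−1)/2` steps
    obtain ⟨n, hn⟩ : ∃ n : ℕ, (r μ : ℕ) = (P.L - 1) / 2 + n := ⟨(r μ : ℕ) - (P.L - 1) / 2, by omega⟩
    have hcast : ((r μ : ℕ) : ℤ) - (((P.L - 1) / 2 : ℕ) : ℤ) = ((n : ℕ) : ℤ) := by rw [hn]; push_cast; ring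
    rw [hcast, runSum_ofNat, segSum]
    refine Finset.sum_eq_zero fun t ht => ?_
    rw [Finset.mem_range] at ht
    apply hA
    have htL : (P.L - 1) / 2 + t < P.L := by omega
    refine ⟨y, _, runSite_mixSite_eq y r μ htL, fun κ hκ => ?_, ?_⟩
    · have hκ' : κ < μ := hκ
      show (((if κ < μ then ⟨(P.L - 1) / 2, by omega⟩ else if κ = μ then ⟨(P.L - 1) / 2 + t, htL⟩ else r κ) : Fin P.L) : ℕ) = _
      rw [if_pos hκ']
    · show (((if μ < μ then ⟨(P.L - 1) / 2, by omega⟩ else if μ = μ then ⟨(P.L - 1) / 2 + t, htL⟩ else r μ) : Fin P.L) : ℕ) + 1 < P.L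
      rw [if_neg (lt_irrefl μ), if_pos rfl]
      simp only
      omega
  · -- backward run of `(L−1)/2 − r_μ` steps
    obtain ⟨m, hm⟩ : ∃ m : ℕ, (P.L - 1) / 2 = (r μ : ℕ) + (m + 1) := ⟨(P.L - 1) / 2 - (r μ : ℕ) - 1, by omega⟩
    have hcast : ((r μ : ℕ) : ℤ) - (((P.L - 1) / 2 : ℕ) : ℤ) = Int.negSucc m := by
      rw [hm, Int.negSucc_eq]; push_cast; ring
    rw [hcast, runSum_negSucc, neg_eq_zero]
    refine Finset.sum_eq_zero fun t ht => ?_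
    rw [Finset.mem_range] at ht
    apply hA
    have htl : t + 1 ≤ (P.L - 1) / 2 := by omega
    have hc : (P.L - 1) / 2 < P.L := by omega
    refine ⟨y, _, update_mixSite_sub_eq y r μ htl hc, fun κ hκ => ?_, ?_⟩
    · have hκ' : κ < μ := hκ
      show (((if κ < μ then ⟨(P.L - 1) / 2, hc⟩ else if κ = μ then ⟨(P.L - 1) / 2 - (t + 1), by omega⟩ else r κ) : Fin P.L) : ℕ) = _
      rw [if_pos hκ']
    · show (((if μ < μ then ⟨(P.L - 1) / 2, hc⟩ else if μ = μ then ⟨(P.L - 1) / 2 - (t + 1), by omega⟩ else r μ) : Fin P.L) : ℕ) + 1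
        < P.L
      rw [if_neg (lt_irrefl μ), if_pos rfl]
      simp only
      omega

/-- **THE CENTRED AXIAL GAUGE IS POINTWISE**: `IsAxial A ↔ A_b = 0` on every bond of the centred staircase trees ([2] p. 303: *"setting u_b = 1
for every bond b of the trees T(y) = ⋃_{x∈B(y)} Γ_{yx}"*, in the additive torus calculus). [cite: BalabanImbrieJaffe1985, (3.4) p.306] -/
theorem isAxial_iff_forall_tree (hj : j + 1 ≤ P.m + P.K) (A : VecField P j V) :
    IsAxial A ↔ ∀ b : PBond P j, IsStairTreeBond b → A b = 0 :=
  ⟨fun hA _ hb => apply_eq_zero_of_isAxial hj hA hb, isAxial_of_forall_tree hj⟩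

/-- **tree bonds are interior bonds**: both endpoints of a stair-tree bond lie in one block (`s_μ + 1 < L`). [cite: BalabanImbrieJaffe1985, (3.4) p.306] -/
theorem blockOf_tgt_eq_of_tree (hj : j + 1 ≤ P.m + P.K) {b : PBond P j} (hb : IsStairTreeBond b) : blockOf b.src = blockOf b.tgt := by
  obtain ⟨y, s, hsrc, -, hlt⟩ := hb
  have htgt : b.tgt = Balaban1983to89.Site.blockSite y (Function.update s b.dir ⟨(s b.dir : ℕ) + 1, hlt⟩) := by
    rw [PBond.tgt, hsrc]
    funext κ
    by_cases hκ : κ = b.dir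
    · subst hκ
      simp only [Balaban1983to89.Site.shift, Function.update_self, Balaban1983to89.Site.blockSite]
      push_cast
      ring
    · simp only [Balaban1983to89.Site.shift, Function.update_of_ne hκ, Balaban1983to89.Site.blockSite]
  rw [hsrc, htgt, Balaban1983to89.Site.blockOf_blockSite hj, Balaban1983to89.Site.blockOf_blockSite hj]

end Stair

/-! ## §2  (2.11) for the `C^{(k)}_{loc}` of record on the torus, no hypothesis -/

section Cloc

variable {P : Params} {j : ℕ} [DecidableEq (PBond P j)]

/-- **every column of the `C^{(k)}` of record is axial**: `b ↦ C(b,b′)` satisfies `IsAxial` (the range of `C^{(k)}` is the constraint subspace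
`Wstep = δ(QB)δ_{Ax}(B)`, file 1's `CE_mem_Wstep`). [cite: BalabanImbrieJaffe1988, (2.11) p.261] -/
theorem isAxial_Cmat_col (b' : PBond P j) : IsAxial (fun b => Cmat P j b b') := by
  have h := ((mem_Wstep j _).1
    (CE_mem_Wstep (P := P) (j := j) ((P.eta j) ^ P.d) ((P.L : ℝ) ^ j) (EuclideanSpace.single b' 1))).2
  have e : (fun b => Cmat P j b b') = (toEj P j).symm (CE P ((P.eta j) ^ P.d) ((P.L : ℝ) ^ j) j (EuclideanSpace.single b' 1)) := by
    funext b
    rw [Cmat_apply]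
    rfl
  rw [e]
  exact h

/-- **tree ROWS of `C^{(k)}` vanish**: `C(b,b′) = 0` for every stair-tree bond `b` (`j + 1 ≤ m + K`). [cite: BalabanImbrieJaffe1988, (2.11) p.261] -/
theorem Cmat_eq_zero_of_tree_left (hj : j + 1 ≤ P.m + P.K) {b : PBond P j} (hb : IsStairTreeBond b) (b' : PBond P j) :
    Cmat P j b b' = 0 :=
  apply_eq_zero_of_isAxial hj (isAxial_Cmat_col b') hb

/-- **tree COLUMNS of `C^{(k)}` vanish** (symmetry of `C^{(k)}`, file 1; `d ≥ 2`). [cite: BalabanImbrieJaffe1988, (2.11) p.261] -/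
theorem Cmat_eq_zero_of_tree_right (hd : 2 ≤ P.d) (hj : j + 1 ≤ P.m + P.K) {b' : PBond P j} (hb' : IsStairTreeBond b') (b : PBond P j) :
    Cmat P j b b' = 0 := by
  rw [Cmat_symm hd hj]
  exact Cmat_eq_zero_of_tree_left hj hb' b

/-- (2.8) keeps the tree rows zero. [cite: BalabanImbrieJaffe1988, (2.8) p.261] -/
theorem Ctil_eq_zero_of_tree_left (hj : j + 1 ≤ P.m + P.K) (R : ℝ) {b : PBond P j} (hb : IsStairTreeBond b) (b' : PBond P j) :
    Ctil P j R b b' = 0 := by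
  rw [Ctil_apply]
  split_ifs
  · exact Cmat_eq_zero_of_tree_left hj hb b'
  · rfl

/-- (2.8) keeps the tree columns zero. [cite: BalabanImbrieJaffe1988, (2.8) p.261] -/
theorem Ctil_eq_zero_of_tree_right (hd : 2 ≤ P.d) (hj : j + 1 ≤ P.m + P.K) (R : ℝ) {b' : PBond P j} (hb' : IsStairTreeBond b')
    (b : PBond P j) : Ctil P j R b b' = 0 := by
  rw [Ctil_apply]
  split_ifs
  · exact Cmat_eq_zero_of_tree_right hd hj hb' b
  · rfl

/-- **(2.11), rows**: `C^{(k)}_{loc}(b,b₀) = 0` for every stair-tree bond `b` and every `b₀` — p02's mechanism `clocKer_row_zero` with its hypotheses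
DISCHARGED: the tree row of `C̃` vanishes and `Q^{s*}` vanishes at the interior bond `b` ((2.17)). [cite: BalabanImbrieJaffe1988, (2.11) p.261] -/
theorem Cloc_eq_zero_of_tree_left (hj : j + 1 ≤ P.m + P.K) (R : ℝ) {b : PBond P j} (hb : IsStairTreeBond b) (b₀ : PBond P j) :
    Cloc P j R b b₀ = 0 :=
  clocKer_row_zero (qKer P j) (qstKer P j) (qsKer (torusBlockBonds P j))
    (fun b' => Ctil_eq_zero_of_tree_left hj R hb b')
    (fun c => qsstKer_interior (torusBlockBonds P j) (blockOf_tgt_eq_of_tree hj hb) c) b₀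

/-- **(2.11), columns**: `C^{(k)}_{loc}(b₀,b) = 0` for every stair-tree bond `b` and every `b₀` (`clocKer_col_zero`; `Q^s` vanishes at interior bonds,
(2.16); `d ≥ 2`). [cite: BalabanImbrieJaffe1988, (2.11) p.261] -/
theorem Cloc_eq_zero_of_tree_right (hd : 2 ≤ P.d) (hj : j + 1 ≤ P.m + P.K) (R : ℝ) {b : PBond P j} (hb : IsStairTreeBond b)
    (b₀ : PBond P j) : Cloc P j R b₀ b = 0 :=
  clocKer_col_zero (qKer P j) (qsstKer (torusBlockBonds P j))
    (fun b' => Ctil_eq_zero_of_tree_right hd hj R hb b')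
    (fun c => qsKer_interior (torusBlockBonds P j) (blockOf_tgt_eq_of_tree hj hb) c) b₀

/-- **(2.11) IN THE TORUS CALCULUS, first member**: every column of `C^{(k)}_{loc}` is axial — the signed staircase sums
`Σ_{b∈Γ_{y,x}} C^{(k)}_{loc}(b,b₀)` vanish for all `y`, `x ∈ B(y)`, `b₀`. [cite: BalabanImbrieJaffe1988, (2.11) p.261] -/
theorem isAxial_Cloc_col (hj : j + 1 ≤ P.m + P.K) (R : ℝ) (b₀ : PBond P j) : IsAxial (fun b => Cloc P j R b b₀) :=
  isAxial_of_forall_tree hj fun _ hb => Cloc_eq_zero_of_tree_left hj R hb b₀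

/-- **(2.11) IN THE TORUS CALCULUS, second member**: every row of `C^{(k)}_{loc}` is axial — `Σ_{b∈Γ_{y,x}} C^{(k)}_{loc}(b₀,b) = 0` (`d ≥ 2`).
[cite: BalabanImbrieJaffe1988, (2.11) p.261] -/
theorem isAxial_Cloc_row (hd : 2 ≤ P.d) (hj : j + 1 ≤ P.m + P.K) (R : ℝ) (b₀ : PBond P j) : IsAxial (fun b => Cloc P j R b₀ b) :=
  isAxial_of_forall_tree hj fun _ hb => Cloc_eq_zero_of_tree_right hd hj R hb b₀

/-- **(2.11) AS TYPED** (r18's `BIJ88Sect2Statements.Eq211`): for EVERY family `Γ` of bond sets drawn from the staircase trees (in particular the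
bond sets of the contours `Γ_{y,x}`), `Σ_{b∈Γ_i} C^{(k)}_{loc}(b,b₀) = Σ_{b∈Γ_i} C^{(k)}_{loc}(b₀,b) = 0` for the `C^{(k)}_{loc}` OF RECORD — no hypothesis
(`d ≥ 2`, `j + 1 ≤ m + K`, every radius `R`). [cite: BalabanImbrieJaffe1988, (2.11) p.261] -/
theorem eq211_Cloc (hd : 2 ≤ P.d) (hj : j + 1 ≤ P.m + P.K) (R : ℝ) {ι : Type*} (Γ : ι → Finset (PBond P j))
    (hΓ : ∀ i, ∀ b ∈ Γ i, IsStairTreeBond b) : Eq211 Γ (Cloc P j R) :=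
  fun i b₀ => ⟨Finset.sum_eq_zero fun b hb => Cloc_eq_zero_of_tree_left hj R (hΓ i b hb) b₀,
    Finset.sum_eq_zero fun b hb => Cloc_eq_zero_of_tree_right hd hj R (hΓ i b hb) b₀⟩

end Cloc

end

end Literature.MathematicalPhysics.QuantumFieldTheory.BalabanImbrieJaffe1984to88.BIJ88Eq211ClocTorus
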